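import Summits.HodgeConjecture.HodgeConjecture.Theses.CyclicUnitaryPowers
import Summits.HodgeConjecture.HodgeConjecture.Theorems.CyclicUnitaryPowersDeckUnitaryCentre
import Summits.HodgeConjecture.HodgeConjecture.Theorems.CyclicUnitaryPowersHodgeTorusDeck
import Summits.HodgeConjecture.HodgeConjecture.Theorems.CyclicUnitaryPowersPrimitiveRootTransfer
import Summits.HodgeConjecture.HodgeConjecture.Theorems.CyclicUnitaryPowersDeckUnitaryCommutatorGeneration

/-!
# The torus relation for crux K2-A: `D' ⊆ Stab` and `Σ_i ω_{c i} = 0` on the coloured support of a Hodge tensor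

Helper for stub T `stub_unitaryTorusLemma` of the crux `PowersHodgeOfDeckCommutators` (stmt-HodgeConjecture-19545,
route `CyclicUnitaryPowers`, line `unitary-kunneth-fft` v6, lane 2 — "the lever").  Two steps of the torus lemma:

* §1 commutators of `U⁰(K)` have determinant-`1` blocks (`det_block_mul`), and by the peeling theorem
  `CyclicUnitaryPowersDeckUnitaryGeneration.mem_of_det_block_eq_one_aux` a tensor fixed by all commutators of `U⁰(K)`
  is fixed by every `δ ∈ U⁰(K)` with `det (δ|E_j) = 1`, `1 ≤ j ≤ p/2` (`tensorSpaceActOver_eq_self_of_det_block_eq_one`);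
* §2 TORUS (`sum_weight_eq_zero`): for the deck-unitary weight-`2` Hodge structure of stub T (`F³ = 0`, `F`-preserving
  `Q`-isometry `s` of prime order `p`, `dim V^s = 1`, eigen-Hodge numbers `e j q` with affine offsets), if `D'` fixes the
  Hodge tensor `ι t` then every colouring `c` with `P_c (ι t) ≠ 0` has `Σ_i ω_{c i} = 0`, `ω_j = e_{j,0} - e_{j,2}`
  (`ω_0 = 0`).  Proof: `h_u = h_ℂ(u, u⁻¹) ∈ U⁰(ℂ)` fixes `ι t` and `det (h_u|E_j) = u ^ (2 ω_j)`
  (`CyclicUnitaryPowersHodgeTorusDeck`); with `u = 2ⁿ`, `n = dim E_j` for all `j`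
  (`CyclicUnitaryPowersPrimitiveRootTransfer.finrank_range_specProj_eq`), and the central `g_λ`, `λ_j = 2 ^ (2 ω_j)`
  (`λ_j λ_{p-j} = 1` by affinity; `CyclicUnitaryPowersDeckUnitaryCentre`), `g_λ⁻¹ h_u ∈ D'`, so `g_λ` fixes `ι t` and
  acts on `(ι t)_c` by `2 ^ (2 Σ_i ω_{c i})` (`CyclicUnitaryPowersColourProjectors`).
-/

noncomputable section

open Module
open scoped TensorProduct BigOperators

namespace Summit.HodgeConjecture.HodgeConjecture.Theorems.CyclicUnitaryPowersTorusRelation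

open Literature.AlgebraicGeometry.Motives
open Literature.AlgebraicGeometry.Motives.HodgeStructure
open Summit.HodgeConjecture.HodgeConjecture.Theorems.CyclicUnitaryPowersSpectralProjectors
open Summit.HodgeConjecture.HodgeConjecture.Theorems.CyclicUnitaryPowersBlockScalars
open Summit.HodgeConjecture.HodgeConjecture.Theorems.CyclicUnitaryPowersDeckUnitaryGroup
open Summit.HodgeConjecture.HodgeConjecture.Theorems.CyclicUnitaryPowersDeckUnitaryGeneration
open Summit.HodgeConjecture.HodgeConjecture.Theorems.CyclicUnitaryPowersDeckUnitaryCommutatorsFix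
open Summit.HodgeConjecture.HodgeConjecture.Theorems.CyclicUnitaryPowersDeckUnitaryCommutatorGeneration
open Summit.HodgeConjecture.HodgeConjecture.Theorems.CyclicUnitaryPowersColourProjectors
open Summit.HodgeConjecture.HodgeConjecture.Theorems.CyclicUnitaryPowersPrimitiveRootTransfer
open Summit.HodgeConjecture.HodgeConjecture.Theorems.CyclicUnitaryPowersHodgeTorusDeck
open Summit.HodgeConjecture.HodgeConjecture.Theorems.CyclicUnitaryPowersDeckUnitaryCentre

/-! ### §1 Commutators of `U⁰(ℂ)` and the subgroup `D'` fix `ι t` -/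

section Commutators

variable {K : Type*} [Field K] [CharZero K] {W : Type*} [AddCommGroup W] [Module K W] [FiniteDimensional K W]
variable {σ : W →ₗ[K] W} {ζ : K} {p : ℕ} {B : LinearMap.BilinForm K W}

omit [FiniteDimensional K W] in
/-- `det (γ|E_j) · det (γ⁻¹|E_j) = 1` on `U⁰(K)`. [folklore] -/
theorem det_block_mul_det_block_inv (hσ : σ ^ p = 1) (hζ : IsPrimitiveRoot ζ p) (hp : 0 < p) {γ : W ≃ₗ[K] W}
    (hγ : γ ∈ centIso σ B) (j : ℕ) :
    LinearMap.det ((γ : W →ₗ[K] W) ∘ₗ specProj σ ζ p j + (1 - specProj σ ζ p j)) *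
      LinearMap.det (((γ⁻¹ : W ≃ₗ[K] W) : W →ₗ[K] W) ∘ₗ specProj σ ζ p j + (1 - specProj σ ζ p j)) = 1 := by
  have h := det_block_mul hσ hζ hp (γ := γ) (δ := γ⁻¹) (inv_mem hγ) j
  rw [mul_inv_cancel] at h
  change LinearMap.det ((1 : Module.End K W) * specProj σ ζ p j + (1 - specProj σ ζ p j)) = _ at h
  rw [one_mul, add_sub_cancel, map_one] at h
  exact h.symm

omit [FiniteDimensional K W] in
/-- **Commutators of `U⁰(K)` have determinant `1` on every eigenblock.** [folklore] -/
theorem det_block_commutator (hσ : σ ^ p = 1) (hζ : IsPrimitiveRoot ζ p) (hp : 0 < p) {a b : W ≃ₗ[K] W}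
    (ha : a ∈ centIso σ B) (hb : b ∈ centIso σ B) (j : ℕ) :
    LinearMap.det (((a * b * a⁻¹ * b⁻¹ : W ≃ₗ[K] W) : W →ₗ[K] W) ∘ₗ specProj σ ζ p j + (1 - specProj σ ζ p j)) = 1 := by
  rw [det_block_mul hσ hζ hp (inv_mem hb) j, det_block_mul hσ hζ hp (inv_mem ha) j, det_block_mul hσ hζ hp hb j]
  have h1 := det_block_mul_det_block_inv hσ hζ hp ha j
  have h2 := det_block_mul_det_block_inv hσ hζ hp hb j
  calc _ = (LinearMap.det ((a : W →ₗ[K] W) ∘ₗ specProj σ ζ p j + (1 - specProj σ ζ p j)) *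
        LinearMap.det (((a⁻¹ : W ≃ₗ[K] W) : W →ₗ[K] W) ∘ₗ specProj σ ζ p j + (1 - specProj σ ζ p j))) *
      (LinearMap.det ((b : W →ₗ[K] W) ∘ₗ specProj σ ζ p j + (1 - specProj σ ζ p j)) *
        LinearMap.det (((b⁻¹ : W ≃ₗ[K] W) : W →ₗ[K] W) ∘ₗ specProj σ ζ p j + (1 - specProj σ ζ p j))) := by ring
    _ = 1 := by rw [h1, h2, one_mul]

/-- **`D' ⊆ Stab`**: if every commutator of `U⁰(K)` fixes a tensor `x`, then so does every `δ ∈ U⁰(K)` with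
`det (δ|E_j) = 1` for `1 ≤ j ≤ p/2` (`p` odd, `B` symmetric nondegenerate). [folklore] -/
theorem tensorSpaceActOver_eq_self_of_det_block_eq_one (hσ : σ ^ p = 1) (hζ : IsPrimitiveRoot ζ p) (hp : 0 < p)
    (hodd : Odd p) (hB : ∀ x y, B (σ x) (σ y) = B x y) (hBn : B.Nondegenerate) (hBs : ∀ x y, B x y = B y x) {r : ℕ}
    (x : hodgeTensorSpaceOver K W r 0)
    (hcomm : ∀ a ∈ centIso σ B, ∀ b ∈ centIso σ B, tensorSpaceActOver (a * b * a⁻¹ * b⁻¹) x = x)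
    {δ : W ≃ₗ[K] W} (hδ : δ ∈ centIso σ B)
    (hdet : ∀ j, 1 ≤ j → j ≤ p / 2 →
      LinearMap.det ((δ : W →ₗ[K] W) ∘ₗ specProj σ ζ p j + (1 - specProj σ ζ p j)) = 1) :
    tensorSpaceActOver δ x = x :=
  mem_of_det_block_eq_one_aux hσ hζ hp hodd hB hBn hBs two_ne_zero (stabilizerOf x) hcomm (p / 2) δ hδ hdet
    (fun m hm hmh _ _ => absurd hmh (by omega))

/-- `∏ a ^ f i = a ^ Σ f i` for integer exponents in a commutative group. [folklore] -/
theorem prod_zpow_eq_zpow_sum {G : Type*} [CommGroup G] {ι : Type*} (s : Finset ι) (f : ι → ℤ) (a : G) :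
    ∏ i ∈ s, a ^ f i = a ^ ∑ i ∈ s, f i := by
  classical
  induction s using Finset.induction_on with
  | empty => simp
  | insert i s hi ih => rw [Finset.prod_insert hi, Finset.sum_insert hi, ih, zpow_add]

end Commutators

/-! ### §2 The torus relation `Σ_i ω_{c i} = 0` on the coloured support of a Hodge tensor -/

section Torus

variable {V : Type} [AddCommGroup V] [Module ℚ V] [Module.Finite ℚ V]

/-- `(2 : ℂ) ^ N = 1` forces `N = 0`. [folklore] -/
theorem int_eq_zero_of_two_zpow_eq_one {N : ℤ} (h : (2 : ℂ) ^ N = 1) : N = 0 := by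
  have h2 : ((2 : ℝ) : ℂ) ^ N = ((2 : ℝ) : ℂ) ^ (0 : ℤ) := by
    rw [zpow_zero, Complex.ofReal_ofNat, h]
  rw [← Complex.ofReal_zpow, ← Complex.ofReal_zpow, Complex.ofReal_inj] at h2
  exact zpow_right_injective₀ (by norm_num) (by norm_num) h2

/-- **The torus relation.**  With the data of stub T (weight-`2` Hodge structure `H` with `F³ = 0`, `F`-preserving
`Q`-isometry `s` of prime order `p`, `dim V^s = 1`, `Q` Hodge–Riemann orthogonal, eigen-Hodge numbers `e j q` for the
primitive root `ζ` with affine offsets), if every element of `U⁰(ℂ)` with determinant-`1` blocks (`1 ≤ j ≤ p/2`) fixes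
the Hodge tensor `ι t`, then every colouring `c` whose component `P_c (ι t)` is non-zero satisfies
`Σ_i ω_{c i} = 0`, `ω_j = e_{j,0} - e_{j,2}` (`ω_0 = 0`). [folklore] -/
theorem sum_weight_eq_zero [HodgeTensorFacts.{0, 0}] (H : HodgeStructure V ((2 : ℕ) : ℤ))
    (Q : LinearMap.BilinForm ℚ V) (s : V →ₗ[ℚ] V) {p : ℕ} (hp : p.Prime) (h3 : 3 ≤ p) (hQn : Q.Nondegenerate)
    (hQF : ∀ (a b : ℤ) (x y : ℂ ⊗[ℚ] V), x ∈ H.F a → y ∈ H.F b → 3 ≤ a + b → Q.baseChange ℂ x y = 0)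
    (hsp : s ^ p = 1) (hsQ : ∀ x y, Q (s x) (s y) = Q x y) (hsF : ∀ a : ℤ, (H.F a).map (s.baseChange ℂ) ≤ H.F a)
    (hF3 : H.F 3 = ⊥) (h1 : Module.finrank ℚ ↥(Module.End.eigenspace s 1) = 1) {ζ : ℂ} (hζ : IsPrimitiveRoot ζ p)
    (e : ℕ → ℕ → ℕ)
    (hE : ∀ j q : ℕ, 1 ≤ j → j < p → q ≤ 2 →
      Module.finrank ℂ ↥(Module.End.eigenspace (s.baseChange ℂ) (ζ ^ j) ⊓ H.piece ((2 : ℤ) - q) q) = e j q)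
    {c₀ : ℤ} (haff : ∀ j ∈ Finset.Ico 1 p, 2 * ((e j 0 : ℤ) - (e j 2 : ℤ)) = c₀ * ((p : ℤ) - 2 * (j : ℤ)))
    {r : ℕ} {t : hodgeTensorSpace V r 0}
    (ht : ∃ p' : ℤ, ((r : ℤ) - ((0 : ℕ) : ℤ)) * ((2 : ℕ) : ℤ) = 2 * p' ∧ t ∈ (H.tensorSpace r 0).hodgeClasses p')
    (hS : ∀ δ ∈ centIso (s.baseChange ℂ) (Q.baseChange ℂ), (∀ j, 1 ≤ j → j ≤ p / 2 →
      LinearMap.det ((δ : ℂ ⊗[ℚ] V →ₗ[ℂ] ℂ ⊗[ℚ] V) ∘ₗ specProj (s.baseChange ℂ) ζ p j + (1 - specProj (s.baseChange ℂ) ζ p j)) = 1) →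
      tensorSpaceActOver δ (tensorSpaceToBaseChange ℂ V r 0 t) = tensorSpaceToBaseChange ℂ V r 0 t)
    (c : Fin r → ℕ) (hc : ∀ i, c i < p) (hne : colourProj (s.baseChange ℂ) ζ p c (tensorSpaceToBaseChange ℂ V r 0 t) ≠ 0) :
    ∑ i, (if c i = 0 then (0 : ℤ) else (e (c i) 0 : ℤ) - (e (c i) 2 : ℤ)) = 0 := by
  have hp0 : 0 < p := hp.pos
  have hodd : Odd p := hp.odd_of_ne_two (by omega)
  have hσ : (s.baseChange ℂ) ^ p = 1 := baseChange_pow_eq_one s hsp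
  have hB : ∀ x y, Q.baseChange ℂ (s.baseChange ℂ x) (s.baseChange ℂ y) = Q.baseChange ℂ x y := baseChange_isometry Q s hsQ
  have hBn : (Q.baseChange ℂ).Nondegenerate := baseChange_nondegenerate Q hQn
  have hn2 : ((2 : ℕ) : ℤ) = 2 := by norm_num
  set n := Module.finrank ℂ ↥(LinearMap.range (specProj (s.baseChange ℂ) ζ p 1)) with hn
  -- the common dimension of the eigenblocks `E_j`, `1 ≤ j < p`
  have hnj : ∀ j, 1 ≤ j → j < p → Module.finrank ℂ ↥(LinearMap.range (specProj (s.baseChange ℂ) ζ p j)) = n := by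
    intro j hj1 hjp
    refine finrank_range_specProj_eq s hσ hζ hp0 (Nat.Coprime.symm ((Nat.Prime.coprime_iff_not_dvd hp).mpr ?_))
    exact fun h => absurd (Nat.le_of_dvd (by omega) h) (by omega)
  -- the weights
  set ω : ℕ → ℤ := fun j => if j = 0 then (0 : ℤ) else (e j 0 : ℤ) - (e j 2 : ℤ) with hω
  have hωrev : ∀ j, 0 < j → j < p → ω j + ω (p - j) = 0 := by
    intro j hj0 hjp
    have ha := haff j (Finset.mem_Ico.mpr ⟨hj0, hjp⟩)
    have hb := haff (p - j) (Finset.mem_Ico.mpr ⟨by omega, by omega⟩)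
    have hj' : j ≠ 0 := by omega
    have hpj' : p - j ≠ 0 := by omega
    simp only [hω, if_neg hj', if_neg hpj']
    have hcast : ((p - j : ℕ) : ℤ) = (p : ℤ) - j := by omega
    rw [hcast] at hb
    linarith
  rcases Nat.eq_zero_or_pos n with hn0 | hnpos
  · -- degenerate case: no eigenblocks off `E_0`, so the support is the zero colouring
    have hzero : ∀ i, c i = 0 := by
      intro i
      by_contra hi
      have hPi : specProj (s.baseChange ℂ) ζ p (c i) = 0 := by
        have hfin := hnj (c i) (Nat.one_le_iff_ne_zero.mpr hi) (hc i)
        rw [hn0, Submodule.finrank_eq_zero] at hfin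
        exact LinearMap.range_eq_bot.mp hfin
      exact hne (by rw [colourProj_def, slotMap_coord_zero i hPi, LinearMap.zero_apply])
    exact Finset.sum_eq_zero fun i _ => by rw [if_pos (hzero i)]
  -- the torus element `h_u`, `u = 2ⁿ`, and the central block scalar `g_λ`, `λ_j = 2 ^ (2 ω_j)`
  set u₀ : ℂˣ := Units.mk0 (2 : ℂ) two_ne_zero with hu₀
  set u : ℂˣ := u₀ ^ n with hu
  set lam : ℕ → ℂ := fun j => ((u₀ ^ (2 * ω j) : ℂˣ) : ℂ) with hlamdef
  have hlam : ∀ j, lam j ≠ 0 := fun j => Units.ne_zero _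
  have hlam0 : lam 0 = 1 := by simp [hlamdef, hω]
  have hrev : ∀ j, 0 < j → j < p → lam j * lam (p - j) = 1 := by
    intro j hj0 hjp
    simp only [hlamdef]
    rw [← Units.val_mul, ← zpow_add, ← mul_add, hωrev j hj0 hjp, mul_zero, zpow_zero, Units.val_one]
  let f : Hom H H := ⟨s, hsF⟩
  have hhmem : H.hodgeTorusC (u, u⁻¹) ∈ centIso (s.baseChange ℂ) (Q.baseChange ℂ) :=
    hodgeTorusC_mem_centIso H hn2 Q hQF f hp0 hsp h1 u
  have hgmem : blockScalarUnit hσ hζ hp0 lam hlam ∈ centIso (s.baseChange ℂ) (Q.baseChange ℂ) :=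
    blockScalarUnit_mem_centIso hσ hζ hp0 lam hlam hB hlam0 hrev
  have hhfix : tensorSpaceActOver (H.hodgeTorusC (u, u⁻¹)) (tensorSpaceToBaseChange ℂ V r 0 t) =
      tensorSpaceToBaseChange ℂ V r 0 t := tensorSpaceActOver_hodgeTorusC_eq_self H ht u
  -- `δ = g_λ⁻¹ h_u` has determinant-one blocks
  have hδfix : tensorSpaceActOver ((blockScalarUnit hσ hζ hp0 lam hlam)⁻¹ * H.hodgeTorusC (u, u⁻¹))
      (tensorSpaceToBaseChange ℂ V r 0 t) = tensorSpaceToBaseChange ℂ V r 0 t := by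
    refine hS _ (mul_mem (inv_mem hgmem) hhmem) fun j hj1 hjh => ?_
    have hjp : j < p := by omega
    have hj0' : j ≠ 0 := by omega
    rw [det_block_mul hσ hζ hp0 hhmem j, det_blockScalarUnit_inv_block hσ hζ hp0 lam hlam hjp, hnj j hj1 hjp]
    have hdet := det_hodgeTorusC_block H f hn2 hF3 hσ hζ hp0 u j
    change LinearMap.det ((H.hodgeTorusC (u, u⁻¹) : ℂ ⊗[ℚ] V →ₗ[ℂ] ℂ ⊗[ℚ] V) ∘ₗ specProj (s.baseChange ℂ) ζ p j +
        (1 - specProj (s.baseChange ℂ) ζ p j)) =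
      (u : ℂ) ^ (2 * Module.finrank ℂ ↥(LinearMap.range (specProj (s.baseChange ℂ) ζ p j) ⊓ H.piece 2 0)) *
        ((u⁻¹ : ℂˣ) : ℂ) ^ (2 * Module.finrank ℂ ↥(LinearMap.range (specProj (s.baseChange ℂ) ζ p j) ⊓ H.piece 0 2)) at hdet
    have he0 : Module.finrank ℂ ↥(LinearMap.range (specProj (s.baseChange ℂ) ζ p j) ⊓ H.piece 2 0) = e j 0 := by
      rw [range_specProj hσ hζ hp0 j]
      convert hE j 0 hj1 hjp (by norm_num) using 4 <;> rfl
    have he2 : Module.finrank ℂ ↥(LinearMap.range (specProj (s.baseChange ℂ) ζ p j) ⊓ H.piece 0 2) = e j 2 := by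
      rw [range_specProj hσ hζ hp0 j]
      convert hE j 2 hj1 hjp le_rfl using 4 <;> rfl
    rw [hdet, he0, he2]
    simp only [hlamdef, if_neg hj0', hω]
    rw [← Units.val_inv_eq_inv_val, ← Units.val_pow_eq_pow_val, ← Units.val_pow_eq_pow_val,
      ← Units.val_pow_eq_pow_val, ← Units.val_mul, ← Units.val_mul, ← Units.val_one]
    congr 1
    rw [hu, ← zpow_natCast, ← zpow_natCast, ← zpow_natCast, ← zpow_natCast (u₀ ^ (n : ℤ))⁻¹, ← zpow_neg, ← zpow_neg,
      ← zpow_mul, ← zpow_mul, ← zpow_mul, ← zpow_add, ← zpow_add]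
    have hexp : -(2 * ((e j 0 : ℤ) - (e j 2 : ℤ))) * (n : ℤ) + ((n : ℤ) * ((2 * e j 0 : ℕ) : ℤ) +
        -(n : ℤ) * ((2 * e j 2 : ℕ) : ℤ)) = 0 := by push_cast; ring
    rw [hexp, zpow_zero]
  -- hence `g_λ = h_u δ⁻¹` fixes `ι t`
  have hgfix : tensorSpaceActOver (blockScalarUnit hσ hζ hp0 lam hlam) (tensorSpaceToBaseChange ℂ V r 0 t) =
      tensorSpaceToBaseChange ℂ V r 0 t := by
    have hmemS : blockScalarUnit hσ hζ hp0 lam hlam ∈ stabilizerOf (tensorSpaceToBaseChange ℂ V r 0 t) := by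
      have h1S : H.hodgeTorusC (u, u⁻¹) ∈ stabilizerOf (tensorSpaceToBaseChange ℂ V r 0 t) := hhfix
      have h2S : (blockScalarUnit hσ hζ hp0 lam hlam)⁻¹ * H.hodgeTorusC (u, u⁻¹) ∈
          stabilizerOf (tensorSpaceToBaseChange ℂ V r 0 t) := hδfix
      have h3 := mul_mem h1S (inv_mem h2S)
      rwa [mul_inv_rev, inv_inv, mul_inv_cancel_left] at h3
    exact hmemS
  -- read off the character on the coloured component `c`
  have hsmul := smul_colourProj_eq_of_fixed hσ hζ hp0 (lam := lam) (x := tensorSpaceToBaseChange ℂ V r 0 t)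
    (by rw [← tensorSpaceActOver_blockScalarUnit hσ hζ hp0 lam hlam]; exact hgfix) hc
  have hprod : ∏ i, lam (c i) = 1 := by
    have h' : (∏ i, lam (c i) - 1) • colourProj (s.baseChange ℂ) ζ p c (tensorSpaceToBaseChange ℂ V r 0 t) = 0 := by
      have e1 := sub_smul (∏ i, lam (c i)) (1 : ℂ)
        (colourProj (s.baseChange ℂ) ζ p c (tensorSpaceToBaseChange ℂ V r 0 t))
      rw [e1, one_smul, hsmul, sub_self]
    rcases smul_eq_zero.mp h' with h'' | h''
    · exact sub_eq_zero.mp h''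
    · exact absurd h'' hne
  simp only [hlamdef] at hprod
  rw [← Units.coe_prod, prod_zpow_eq_zpow_sum, ← Finset.mul_sum, Units.val_zpow_eq_zpow_val, hu₀, Units.val_mk0] at hprod
  have h0 := int_eq_zero_of_two_zpow_eq_one hprod
  simp only [mul_eq_zero, OfNat.ofNat_ne_zero, false_or] at h0
  simpa only [hω] using h0

end Torus

end Summit.HodgeConjecture.HodgeConjecture.Theorems.CyclicUnitaryPowersTorusRelation

end
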